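import Summits.Ventures.PercRepro.C026KCut

/-!
# The K-cut chain: an explicit injection Bad ↪ GG inside the cluster cubes (mine-3 §45 (a)(7); gen 51)

`kcut S = S` as soon as `c` reaches `t` avoiding `one` (the `t`-side is then empty), so the iterates
`kcut^[n] S` form a chain that stabilises exactly when `t ∈ redReach`.  For a Bad configuration `S`
(«neither side good»): every iterate lies in the cluster cube of `S` (`kcutIter_inCube`); the
chain strictly opens edges while `t ∉ redReach`, since a Bad configuration has a red vertex inside
the blue cluster of `t` (`exists_mem_redReach_mem_cluster_of_bad`) and this persists
(`exists_mem_mem_kcut`), so after `|E|` steps `c` reaches `t` (`mem_redReach_kcutIter_card`) and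
the value is GG (`kcutChain_gg`); `kcutChain` is injective on the Bad configurations
(`kcutChain_injOn`): chains that meet have the same origin (`kcut` is injective where it moves,
fixes reached configurations, and a Bad configuration is never the image of a moving step).
**(CUT-INJ)**: on every family closed under the K-cut map, `kcutChain` injects the Bad members into
the GG members of their own cluster cubes (`card_bad_le_card_gg_chain`).
-/

namespace PercRepro
namespace MultiGraph

open Finset Function
variable {V E : Type*} {G : MultiGraph V E}

/-- The `t`-side is empty once `c` reaches `t` avoiding `one`. -/
theorem tSide_eq_empty_of_mem {S : Config E} {one c t : V} (ht : t ∈ G.redReach S one c) :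
    G.tSide S one c t = ∅ := by
  ext v
  simp only [mem_tSide, Set.mem_empty_iff_false, iff_false]
  exact fun h => h.1 ht

/-- The K-cut map fixes every configuration in which `c` reaches `t` avoiding `one`. -/
theorem kcut_eq_self_of_mem {S : Config E} {one c t : V} (ht : t ∈ G.redReach S one c) :
    G.kcut S one c t = S := by
  funext e
  have hX : G.kcutEdges S one c t e = false := by
    cases hX : G.kcutEdges S one c t e
    · rfl
    · exfalso
      rw [kcutEdges_eq_true_iff] at hX
      rcases hX.2 with ⟨_, h⟩ | ⟨_, h⟩ <;> simp [tSide_eq_empty_of_mem ht] at h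
  rw [kcut, sup_apply_of_eq_false hX]

/-- The red cluster is monotone in the configuration. -/
theorem redReach_mono {S S' : Config E} (h : S ≤ S') (one c : V) :
    G.redReach S one c ⊆ G.redReach S' one c := by
  intro v hv
  exact ⟨hv.1, reflTransGen_of_imp (fun _ _ hxy => ⟨hxy.1.mono h, hxy.2⟩) hv.2⟩

/-- `S ≤ kcut^[n] S`. -/
theorem le_kcut_iterate (S : Config E) (one c t : V) (n : ℕ) :
    S ≤ (fun T => G.kcut T one c t)^[n] S := by
  induction n with
  | zero => exact le_rfl
  | succ n ih => rw [iterate_succ_apply']; exact ih.trans (le_kcut _ one c t)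

/-- The standing hypotheses pass to every larger configuration. -/
theorem hyps_mono {S S' : Config E} {one c t : V} (h : S ≤ S')
    (hS : G.Conn S c one ∧ one ∉ G.cluster Sᶜ t) : G.Conn S' c one ∧ one ∉ G.cluster S'ᶜ t :=
  ⟨hS.1.mono h, fun h' => hS.2 (G.cluster_mono (compl_le_compl h) t h')⟩

/-- Cluster-cube membership: `T` opens only edges of `S` inside the blue cluster of `t`. -/
def InCube (G : MultiGraph V E) (S T : Config E) (t : V) : Prop :=
  S ≤ T ∧ ∀ e, S e = false → T e = true → G.fst e ∈ G.cluster Sᶜ t ∧ G.snd e ∈ G.cluster Sᶜ t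

/-- The cube relation is transitive. -/
theorem InCube.trans {S T U : Config E} {t : V} (h1 : G.InCube S T t) (h2 : G.InCube T U t) :
    G.InCube S U t := by
  refine ⟨h1.1.trans h2.1, fun e hS hU => ?_⟩
  cases hT : T e
  · have := h2.2 e hT hU
    exact ⟨G.cluster_mono (compl_le_compl h1.1) t this.1,
      G.cluster_mono (compl_le_compl h1.1) t this.2⟩
  · exact h1.2 e hS hT

/-- `kcut S` lies in the cluster cube of `S`. -/
theorem inCube_kcut (S : Config E) (one c t : V) : G.InCube S (G.kcut S one c t) t := by
  refine ⟨le_kcut S one c t, fun e hS hT => ?_⟩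
  rw [kcut, configSup_eq_true_iff] at hT
  rcases hT with h | h
  · rw [hS] at h; exact absurd h (by decide)
  · exact (kcutEdges_mem_cluster h).2

/-- Every iterate of the K-cut map lies in the cluster cube of the start. -/
theorem kcutIter_inCube (S : Config E) (one c t : V) (n : ℕ) :
    G.InCube S ((fun T => G.kcut T one c t)^[n] S) t := by
  induction n with
  | zero =>
    refine ⟨le_rfl, fun e hS hT => ?_⟩
    rw [iterate_zero_apply, hS] at hT
    exact absurd hT (by decide)
  | succ n ih => rw [iterate_succ_apply']; exact ih.trans (inCube_kcut _ one c t)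

/-- A walk whose step sources avoid `W`, starting and ending outside `W`, is an avoiding walk. -/
theorem walkAvoiding_of_sources {ω : Config E} {W : Set V} {u : V} :
    ∀ {p : V}, Relation.ReflTransGen (fun x y => G.OpenAdj ω x y ∧ x ∉ W) u p → u ∉ W → p ∉ W →
      G.WalkAvoiding ω W u p := by
  intro p h hu hp
  induction h with
  | refl => exact WalkAvoiding.refl hu
  | @tail a b _ hab ih => exact (ih hab.2).tail_of_not_mem hab.1 hp

/-- A red vertex inside the blue cluster of `t` forces a K-cut edge (when `t ∉ redReach`). -/
theorem exists_kcutEdge_of_mem_mem {S : Config E} {one c t v : V}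
    (ht : t ∉ G.redReach S one c) (hvK : v ∈ G.redReach S one c) (hvD : v ∈ G.cluster Sᶜ t) :
    ∃ e, G.kcutEdges S one c t e = true := by
  obtain ⟨w, hw, hwalk⟩ :=
    exists_first_mem_of_conn (G := G) (ω := Sᶜ) (Y := G.redReach S one c) ((G.mem_cluster).1 hvD) hvK
  rcases Relation.ReflTransGen.cases_tail hwalk with hwt | ⟨p, hp, hpw⟩
  · exact absurd (hwt ▸ hw) ht
  · obtain ⟨⟨e, he, hend⟩, hpK⟩ := hpw
    have hpT : p ∈ G.tSide S one c t := walkAvoiding_of_sources hp ht hpK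
    refine ⟨e, ?_⟩
    rw [kcutEdges_eq_true_iff]
    refine ⟨(compl_apply_eq_true_iff S e).1 he, ?_⟩
    rcases hend with ⟨h1, h2⟩ | ⟨h1, h2⟩
    · exact Or.inr ⟨h2 ▸ hw, h1 ▸ hpT⟩
    · exact Or.inl ⟨h1 ▸ hw, h2 ▸ hpT⟩

/-- A K-cut edge produces a red vertex inside the blue cluster of the image. -/
theorem exists_mem_mem_kcut {S : Config E} {one c t : V} (hone : one ∉ G.cluster Sᶜ t) {e : E}
    (he : G.kcutEdges S one c t e = true) :
    ∃ y, y ∈ G.redReach (G.kcut S one c t) one c ∧ y ∈ G.cluster (G.kcut S one c t)ᶜ t := by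
  have hT : (G.kcut S one c t) e = true := (configSup_eq_true_iff _ _ e).2 (Or.inr he)
  rw [kcutEdges_eq_true_iff] at he
  obtain ⟨_, h⟩ := he
  have ht : t ∉ G.redReach S one c := by
    intro ht
    rcases h with ⟨_, h2⟩ | ⟨_, h2⟩ <;> simp [tSide_eq_empty_of_mem ht] at h2
  rw [cluster_kcut ht]
  have hnot : ∀ y, y ∈ G.tSide S one c t → y ∉ ({one} : Set V) := by
    intro y hy hy1
    rw [Set.mem_singleton_iff] at hy1
    rw [hy1] at hy
    exact hone (tSide_subset_cluster S one c t hy)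
  rcases h with ⟨h1, h2⟩ | ⟨h1, h2⟩
  · refine ⟨G.snd e, ?_, h2⟩
    exact (redReach_mono (le_kcut S one c t) one c h1).tail_of_not_mem (G.openAdj_of_open e hT)
      (hnot _ h2)
  · refine ⟨G.fst e, ?_, h2⟩
    exact (redReach_mono (le_kcut S one c t) one c h1).tail_of_not_mem
      (G.openAdj_of_open e hT).symm (hnot _ h2)

/-- A Bad configuration has a red vertex inside the blue cluster of `t` (a red walk from `c` to
`one` meets the blue cluster, and its vertices before `one` are red-reachable). -/
theorem exists_mem_redReach_mem_cluster_of_bad {S : Config E} {one c t : V} (hc : c ≠ one)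
    (hS : G.Conn S c one ∧ one ∉ G.cluster Sᶜ t)
    (hbad : ¬ G.WalkAvoiding S (G.cluster Sᶜ t) c one) :
    ∃ v, v ∈ G.redReach S one c ∧ v ∈ G.cluster Sᶜ t := by
  obtain ⟨w, hw, hwalk⟩ := exists_first_mem_of_conn hS.1 (Set.mem_singleton one)
  rw [Set.mem_singleton_iff] at hw
  rw [hw] at hwalk
  have key : ∀ x, Relation.ReflTransGen (fun x y => G.OpenAdj S x y ∧ x ∉ ({one} : Set V)) c x →
      (G.WalkAvoiding S (G.cluster Sᶜ t) c x ∧ (x = one ∨ x ∈ G.redReach S one c)) ∨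
        ∃ v, v ∈ G.redReach S one c ∧ v ∈ G.cluster Sᶜ t := by
    intro x hx
    induction hx with
    | refl =>
      by_cases hcD : c ∈ G.cluster Sᶜ t
      · exact Or.inr ⟨c, self_mem_redReach hc, hcD⟩
      · exact Or.inl ⟨WalkAvoiding.refl hcD, Or.inr (self_mem_redReach hc)⟩
    | @tail a b _ hab ih =>
      rcases ih with ⟨hwalk, ha⟩ | h
      · have haK : a ∈ G.redReach S one c := by
          rcases ha with h | h
          · exact absurd (Set.mem_singleton_iff.2 h) hab.2
          · exact h
        by_cases hbD : b ∈ G.cluster Sᶜ t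
        · have hb1 : b ∉ ({one} : Set V) := by
            intro h
            rw [Set.mem_singleton_iff] at h
            rw [h] at hbD
            exact hS.2 hbD
          exact Or.inr ⟨b, haK.tail_of_not_mem hab.1 hb1, hbD⟩
        · refine Or.inl ⟨hwalk.tail_of_not_mem hab.1 hbD, ?_⟩
          by_cases hb1 : b = one
          · exact Or.inl hb1
          · exact Or.inr (haK.tail_of_not_mem hab.1 (by simpa using hb1))
      · exact Or.inr h
  rcases key one hwalk with ⟨hwalk', _⟩ | h
  · exact absurd hwalk' hbad
  · exact h

section Chain

variable [Fintype E]

omit G in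
/-- The number of open edges of a configuration. -/
def openCount (S : Config E) : ℕ := (univ.filter fun e => S e = true).card

omit G in
/-- At most `|E|` edges are open. -/
theorem openCount_le_card (S : Config E) : openCount S ≤ Fintype.card E := by
  unfold openCount
  rw [← card_univ]
  exact card_filter_le _ _

omit G in
/-- Opening at least one more edge strictly increases the number of open edges. -/
theorem openCount_lt_of_lt {S T : Config E} (h : S ≤ T) {e : E} (hS : S e = false)
    (hT : T e = true) : openCount S < openCount T := by
  unfold openCount
  refine card_lt_card ((Finset.ssubset_iff_of_subset ?_).2 ⟨e, ?_, ?_⟩)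
  · intro x hx
    rw [mem_filter] at hx ⊢
    exact ⟨mem_univ _, Bool.le_iff_imp.1 (h x) hx.2⟩
  · exact mem_filter.2 ⟨mem_univ _, hT⟩
  · intro hx
    rw [mem_filter, hS] at hx; exact absurd hx.2 (by decide)

omit [Fintype E] in
/-- Iterates of the K-cut map are monotone in the number of steps. -/
theorem kcut_iterate_le_iterate (S : Config E) (one c t : V) {i j : ℕ} (h : i ≤ j) :
    (fun T => G.kcut T one c t)^[i] S ≤ (fun T => G.kcut T one c t)^[j] S := by
  obtain ⟨k, rfl⟩ := Nat.exists_eq_add_of_le h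
  rw [add_comm, iterate_add_apply]
  exact le_kcut_iterate _ one c t k

/-- **Termination**: for a Bad configuration, `|E|` K-cut steps make `c` reach `t`. -/
theorem mem_redReach_kcutIter_card {S : Config E} {one c t : V} (hc : c ≠ one)
    (hS : G.Conn S c one ∧ one ∉ G.cluster Sᶜ t)
    (hbad : ¬ G.WalkAvoiding S (G.cluster Sᶜ t) c one) :
    t ∈ G.redReach ((fun T => G.kcut T one c t)^[Fintype.card E] S) one c := by
  by_contra hN
  -- `t` is unreached at every step `i ≤ |E|`
  have hnot : ∀ i, i ≤ Fintype.card E → t ∉ G.redReach ((fun T => G.kcut T one c t)^[i] S) one c :=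
    fun i hi hti => hN (redReach_mono (kcut_iterate_le_iterate S one c t hi) one c hti)
  -- the invariant: a red vertex inside the blue cluster, and at least `i` open edges
  have key : ∀ i, i ≤ Fintype.card E + 1 →
      (∃ v, v ∈ G.redReach ((fun T => G.kcut T one c t)^[i] S) one c ∧
        v ∈ G.cluster ((fun T => G.kcut T one c t)^[i] S)ᶜ t) ∧
        i ≤ openCount ((fun T => G.kcut T one c t)^[i] S) := by
    intro i
    induction i with
    | zero =>
      intro _
      rw [iterate_zero_apply]
      exact ⟨exists_mem_redReach_mem_cluster_of_bad hc hS hbad, Nat.zero_le _⟩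
    | succ i ih =>
      intro hi
      obtain ⟨⟨v, hvK, hvD⟩, hcount⟩ := ih (Nat.le_of_succ_le hi)
      have hti : t ∉ G.redReach ((fun T => G.kcut T one c t)^[i] S) one c :=
        hnot i (Nat.le_of_succ_le_succ hi)
      obtain ⟨e, he⟩ := exists_kcutEdge_of_mem_mem hti hvK hvD
      have hSi := hyps_mono (G := G) (le_kcut_iterate (G := G) S one c t i) hS
      rw [iterate_succ_apply']
      refine ⟨exists_mem_mem_kcut hSi.2 he, ?_⟩
      have hSe : ((fun T => G.kcut T one c t)^[i] S) e = false := (kcutEdges_eq_true_iff.1 he).1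
      have hTe : (G.kcut ((fun T => G.kcut T one c t)^[i] S) one c t) e = true :=
        (configSup_eq_true_iff _ _ e).2 (Or.inr he)
      have := openCount_lt_of_lt (le_kcut ((fun T => G.kcut T one c t)^[i] S) one c t) hSe hTe
      show i + 1 ≤ openCount (G.kcut ((fun T => G.kcut T one c t)^[i] S) one c t)
      omega
  have h1 := (key (Fintype.card E + 1) le_rfl).2
  have h2 := openCount_le_card ((fun T => G.kcut T one c t)^[Fintype.card E + 1] S)
  omega

omit [Fintype E] in
/-- Along the chain, every iterate either still has `t` unreached or has `Good₂ = 1`. -/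
theorem kcutIter_unreached_or_walkAvoiding {S : Config E} {one c t : V} (hc : c ≠ one)
    (hS : G.Conn S c one ∧ one ∉ G.cluster Sᶜ t) (ht : t ∉ G.redReach S one c) (i : ℕ) :
    t ∉ G.redReach ((fun T => G.kcut T one c t)^[i] S) one c ∨
      G.WalkAvoiding ((fun T => G.kcut T one c t)^[i] S)
        (G.cluster ((fun T => G.kcut T one c t)^[i] S)ᶜ t) c one := by
  induction i with
  | zero => rw [iterate_zero_apply]; exact Or.inl ht
  | succ i ih =>
    rw [iterate_succ_apply']
    have hSi := hyps_mono (G := G) (le_kcut_iterate (G := G) S one c t i) hS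
    by_cases hti : t ∈ G.redReach ((fun T => G.kcut T one c t)^[i] S) one c
    · rw [kcut_eq_self_of_mem hti]
      rcases ih with h | h
      · exact absurd hti h
      · exact Or.inr h
    · exact Or.inr (walkAvoiding_kcut hc hti hSi.2 hSi.1)

omit [Fintype E] in
/-- **Injectivity**: two K-cut chains from Bad configurations that meet have the same origin
(strong induction on the total number of steps). -/
theorem kcutIter_inj {one c t : V} (hc : c ≠ one) : ∀ n i j, i + j = n → ∀ S S' : Config E,
    (G.Conn S c one ∧ one ∉ G.cluster Sᶜ t) → (G.Conn S' c one ∧ one ∉ G.cluster S'ᶜ t) →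
    t ∉ G.redReach S one c → ¬ G.WalkAvoiding S (G.cluster Sᶜ t) c one →
    t ∉ G.redReach S' one c → ¬ G.WalkAvoiding S' (G.cluster S'ᶜ t) c one →
    (fun T => G.kcut T one c t)^[i] S = (fun T => G.kcut T one c t)^[j] S' → S = S' := by
  intro n
  induction n using Nat.strong_induction_on with
  | _ n ih =>
    intro i j hn S S' hS hS' ht hbad ht' hbad' heq
    cases i with
    | zero =>
      cases j with
      | zero => rwa [iterate_zero_apply, iterate_zero_apply] at heq
      | succ j =>
        rw [iterate_zero_apply, iterate_succ_apply'] at heq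
        have hS'j := hyps_mono (G := G) (le_kcut_iterate (G := G) S' one c t j) hS'
        by_cases htj : t ∈ G.redReach ((fun T => G.kcut T one c t)^[j] S') one c
        · rw [kcut_eq_self_of_mem htj] at heq
          exact ih j (by omega) 0 j (Nat.zero_add j) S S' hS hS' ht hbad ht' hbad'
            (by rw [iterate_zero_apply]; exact heq)
        · exfalso
          have := walkAvoiding_kcut hc htj hS'j.2 hS'j.1
          rw [← heq] at this
          exact hbad this
    | succ i =>
      cases j with
      | zero =>
        rw [iterate_succ_apply', iterate_zero_apply] at heq
        have hSi := hyps_mono (G := G) (le_kcut_iterate (G := G) S one c t i) hS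
        by_cases hti : t ∈ G.redReach ((fun T => G.kcut T one c t)^[i] S) one c
        · rw [kcut_eq_self_of_mem hti] at heq
          exact ih i (by omega) i 0 rfl S S' hS hS' ht hbad ht' hbad'
            (by rw [iterate_zero_apply]; exact heq)
        · exfalso
          have := walkAvoiding_kcut hc hti hSi.2 hSi.1
          rw [heq] at this
          exact hbad' this
      | succ j =>
        rw [iterate_succ_apply', iterate_succ_apply'] at heq
        have hSi := hyps_mono (G := G) (le_kcut_iterate (G := G) S one c t i) hS
        have hS'j := hyps_mono (G := G) (le_kcut_iterate (G := G) S' one c t j) hS'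
        by_cases hti : t ∈ G.redReach ((fun T => G.kcut T one c t)^[i] S) one c <;>
          by_cases htj : t ∈ G.redReach ((fun T => G.kcut T one c t)^[j] S') one c
        · rw [kcut_eq_self_of_mem hti, kcut_eq_self_of_mem htj] at heq
          exact ih (i + j) (by omega) i j rfl S S' hS hS' ht hbad ht' hbad' heq
        · rw [kcut_eq_self_of_mem hti] at heq
          exact ih (i + (j + 1)) (by omega) i (j + 1) rfl S S' hS hS' ht hbad ht' hbad'
            (by rw [iterate_succ_apply']; exact heq)
        · rw [kcut_eq_self_of_mem htj] at heq
          exact ih ((i + 1) + j) (by omega) (i + 1) j rfl S S' hS hS' ht hbad ht' hbad'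
            (by rw [iterate_succ_apply']; exact heq)
        · have := kcut_injective hc hti htj hSi.2 hS'j.2 heq
          exact ih (i + j) (by omega) i j rfl S S' hS hS' ht hbad ht' hbad' this

/-- **The K-cut chain**: `|E|` iterations of the K-cut map. -/
noncomputable def kcutChain (G : MultiGraph V E) (one c t : V) (S : Config E) : Config E :=
  (fun T => G.kcut T one c t)^[Fintype.card E] S

/-- The chain value lies in the cluster cube of its argument. -/
theorem kcutChain_inCube (S : Config E) (one c t : V) : G.InCube S (G.kcutChain one c t S) t :=
  kcutIter_inCube S one c t _

/-- **The chain value of a Bad configuration is GG.** -/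
theorem kcutChain_gg {S : Config E} {one c t : V} (hc : c ≠ one)
    (hS : G.Conn S c one ∧ one ∉ G.cluster Sᶜ t) (ht : t ∉ G.redReach S one c)
    (hbad : ¬ G.WalkAvoiding S (G.cluster Sᶜ t) c one) :
    t ∈ G.redReach (G.kcutChain one c t S) one c ∧
      G.WalkAvoiding (G.kcutChain one c t S) (G.cluster (G.kcutChain one c t S)ᶜ t) c one := by
  have h1 := mem_redReach_kcutIter_card hc hS hbad
  refine ⟨h1, ?_⟩
  rcases kcutIter_unreached_or_walkAvoiding hc hS ht (Fintype.card E) with h | h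
  · exact absurd h1 h
  · exact h

/-- **(CUT-INJ), explicit form**: the K-cut chain is injective on the Bad configurations. -/
theorem kcutChain_injOn {one c t : V} (hc : c ≠ one) :
    Set.InjOn (G.kcutChain one c t) {S | (G.Conn S c one ∧ one ∉ G.cluster Sᶜ t) ∧
      t ∉ G.redReach S one c ∧ ¬ G.WalkAvoiding S (G.cluster Sᶜ t) c one} := by
  intro S hS S' hS' heq
  exact kcutIter_inj hc _ _ _ rfl S S' hS.1 hS'.1 hS.2.1 hS.2.2 hS'.2.1 hS'.2.2 heq

/-- The chain stays inside a family closed under the K-cut map. -/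
theorem kcutChain_mem {one c t : V} {𝒰 : Finset (Config E)}
    (hclosed : ∀ S ∈ 𝒰, t ∉ G.redReach S one c → G.kcut S one c t ∈ 𝒰) {S : Config E}
    (hS : S ∈ 𝒰) : G.kcutChain one c t S ∈ 𝒰 := by
  unfold kcutChain
  induction Fintype.card E with
  | zero => rwa [iterate_zero_apply]
  | succ n ih =>
    rw [iterate_succ_apply']
    by_cases h : t ∈ G.redReach ((fun T => G.kcut T one c t)^[n] S) one c
    · rwa [kcut_eq_self_of_mem h]
    · exact hclosed _ ih h

open Classical in
/-- **(CUT-INJ)** on a family closed under the K-cut map: the K-cut chain injects the Bad members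
into the GG members of their own cluster cubes, hence `#Bad ≤ #GG`. -/
theorem card_bad_le_card_gg_chain {one c t : V} (hc : c ≠ one) (𝒰 : Finset (Config E))
    (hmem : ∀ S ∈ 𝒰, G.Conn S c one ∧ one ∉ G.cluster Sᶜ t)
    (hclosed : ∀ S ∈ 𝒰, t ∉ G.redReach S one c → G.kcut S one c t ∈ 𝒰) :
    (𝒰.filter fun S => t ∉ G.redReach S one c ∧
        ¬ G.WalkAvoiding S (G.cluster Sᶜ t) c one).card ≤
      (𝒰.filter fun S => t ∈ G.redReach S one c ∧
        G.WalkAvoiding S (G.cluster Sᶜ t) c one).card := by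
  refine card_le_card_of_injOn (G.kcutChain one c t) ?_ ?_
  · intro S hS
    rw [coe_filter] at hS
    rw [coe_filter]
    exact ⟨kcutChain_mem hclosed hS.1, kcutChain_gg hc (hmem S hS.1) hS.2.1 hS.2.2⟩
  · intro S hS S' hS' heq
    rw [coe_filter] at hS hS'
    exact kcutChain_injOn hc ⟨hmem S hS.1, hS.2⟩ ⟨hmem S' hS'.1, hS'.2⟩ heq

end Chain

end MultiGraph
end PercRepro
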